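import Mathlib
import Summits.QuantumFields.YangMills.Theorems.TransportFieldKernelDerivativeLinear
import HarnessLib

/-!
# Transport-field regularity kit, tranche 3: the Feynman–Hellmann derivative of the vacuum is LINEAR in the generator and JOINTLY
# CONTINUOUS; consequences for right `expPauli` shifts with configuration-dependent directions

Continuation of `TransportFieldKernelDerivative` (tranche 1) and `TransportFieldVacuumRightShift` (tranche 2).  Writing
`S'_X(U) = Σ_p −Re tr Leibniz_X(U,p)` for the explicit derivative of the Wilson action along the left shift with generator `X` at the edge `e`,
`D_X(U,V) = K_β(U,V)(β Re tr(XU_eV_e⁻¹) − (β/2)S'_X(U))` for the Feynman–Hellmann density and `FH_X(U) = λ₀⁻¹∫ D_X(U,V)Ω(V)dV` for the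
derivative of the vacuum (tranche 1 `hasDerivAt_vacuum_shift`), this file proves:
* (tranche 3a, `TransportFieldKernelDerivativeLinear`: `S'` and `D` are real-linear in `X` and jointly continuous;)
* ★ `fh_add`, `fh_smul` — `FH` is real-linear in `X`; ★ `continuous_fh_of_continuous` — for a CONTINUOUS generator field `U ↦ X(U)`,
  `U ↦ FH_{X(U)}(U)` is continuous (dominated convergence on the compact configuration space), hence measurable and bounded;
* ★★ `deriv_vacuum_rightShift_add`, `deriv_vacuum_rightShift_smul` — the `deriv … 0` of the vacuum along the right shift
  `U ↦ U[e ↦ U_e expPauli(t•a)]` is ADDITIVE and HOMOGENEOUS in the direction `a ∈ ℝ³` (the conjugate generator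
  `U_e su2Coord(a) U_e⁻¹` is linear in `a`);
* ★★ `continuous_deriv_vacuum_rightShift` — for a continuous direction field `a : Config → ℝ³`,
  `U ↦ deriv (t ↦ Ω(U[e ↦ U_e expPauli(t•a(U))])) 0` is continuous, hence (`…_bounded`, `…_measurable`) bounded and measurable.
These are exactly the facts the stubs `stub_linearSplit` ⟨23354⟩ / `stub_cauchySchwarzCommutator` ⟨23379⟩ need about `XΩ = Σ_x deriv(…)0`.
HONEST FRAMING: fixed-lattice calculus; no claim about the cruxes, K2a or the YM mass gap.  No `sorry`, no new axiom, no new definition.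
References: [cite: Creutz2022, Ch. 11]; [cite: ReedSimonIV1978, Thm. XIII.43]; [cite: Balaban1985UV3, p. 260].
-/

set_option autoImplicit false

noncomputable section

open MeasureTheory Filter Topology NormedSpace
open scoped BigOperators Matrix.Norms.Frobenius
open Literature.MathematicalPhysics.QuantumFieldTheory (GaugeConfig Site Edge Plaquette wilsonAction plaquetteHolonomy)
open Literature.MathematicalPhysics.QuantumLattice (secondCountableTopology_su2)
open Literature.MathematicalPhysics.QuantumFieldTheory.Balaban1983to89.B10Eq18SigmaSU2 (su2Coord)
open Literature.MathematicalPhysics.QuantumFieldTheory.Balaban1983to89.B10Eq18SigmaSU2Haar (expPauli coe_expPauli)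
open Summit.QuantumFields.YangMills.Theorems.EquipartitionPinsProbe.TangentSteinFiniteBeta (exists_abs_le_of_continuous)

namespace Summit.QuantumFields.YangMills.Theorems.TransportField

open Summit.QuantumFields.YangMills.Theorems.FemtoTransferGap

variable {L : ℕ} [NeZero L]

/-! ## §4 ★ The Feynman–Hellmann derivative `FH_X(U)`: linear in `X`; continuous along continuous generator fields -/

/-- Integrability of `V ↦ D_X(U,V)Ω(V)` (bounded × bounded measurable on a probability space). [folklore] -/
theorem integrable_kernelDeriv_mul (β : ℝ) (e : Edge 3 L) (X : Matrix (Fin 2) (Fin 2) ℂ) (U : GaugeConfig 3 L SU2)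
    {Ω : GaugeConfig 3 L SU2 → ℝ} (hΩ : IsPhys Ω) :
    Integrable (fun V => (transferKernel su2Rep β U V * (β * (X * su2Rep (U e) * su2Rep ((V e)⁻¹)).trace.re - β / 2 *
      (∑ p : Plaquette 3 L,
        -(((((if (p.1, p.2.1.1) = e then X * su2Rep (U e) else 0) * su2Rep (U (p.1.shift p.2.1.1, p.2.1.2)) +
              su2Rep (U (p.1, p.2.1.1)) * (if (p.1.shift p.2.1.1, p.2.1.2) = e then X * su2Rep (U e) else 0)) *
                su2Rep ((U (p.1.shift p.2.1.2, p.2.1.1))⁻¹) +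
            su2Rep (U (p.1, p.2.1.1)) * su2Rep (U (p.1.shift p.2.1.1, p.2.1.2)) *
              (if (p.1.shift p.2.1.2, p.2.1.1) = e then su2Rep ((U e)⁻¹) * (-X) else 0)) * su2Rep ((U (p.1, p.2.1.2))⁻¹) +
          su2Rep (U (p.1, p.2.1.1)) * su2Rep (U (p.1.shift p.2.1.1, p.2.1.2)) * su2Rep ((U (p.1.shift p.2.1.2, p.2.1.1))⁻¹) *
            (if (p.1, p.2.1.2) = e then su2Rep ((U e)⁻¹) * (-X) else 0)).trace.re)))) * Ω V) (configMeasure SU2 L) := by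
  haveI : SecondCountableTopology SU2 := secondCountableTopology_su2
  haveI : IsProbabilityMeasure (configMeasure SU2 L) := by unfold configMeasure; infer_instance
  have hc : Continuous fun V : GaugeConfig 3 L SU2 => (transferKernel su2Rep β U V * (β * (X * su2Rep (U e) * su2Rep ((V e)⁻¹)).trace.re - β / 2 *
      (∑ p : Plaquette 3 L,
        -(((((if (p.1, p.2.1.1) = e then X * su2Rep (U e) else 0) * su2Rep (U (p.1.shift p.2.1.1, p.2.1.2)) +
              su2Rep (U (p.1, p.2.1.1)) * (if (p.1.shift p.2.1.1, p.2.1.2) = e then X * su2Rep (U e) else 0)) *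
                su2Rep ((U (p.1.shift p.2.1.2, p.2.1.1))⁻¹) +
            su2Rep (U (p.1, p.2.1.1)) * su2Rep (U (p.1.shift p.2.1.1, p.2.1.2)) *
              (if (p.1.shift p.2.1.2, p.2.1.1) = e then su2Rep ((U e)⁻¹) * (-X) else 0)) * su2Rep ((U (p.1, p.2.1.2))⁻¹) +
          su2Rep (U (p.1, p.2.1.1)) * su2Rep (U (p.1.shift p.2.1.1, p.2.1.2)) * su2Rep ((U (p.1.shift p.2.1.2, p.2.1.1))⁻¹) *
            (if (p.1, p.2.1.2) = e then su2Rep ((U e)⁻¹) * (-X) else 0)).trace.re)))) :=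
    continuous_kernelDeriv_comp (L := L) β e continuous_const continuous_const continuous_id
  obtain ⟨CD, -, hCD⟩ := exists_abs_le_of_continuous hc
  obtain ⟨CΩ, hCΩ⟩ := hΩ.bounded
  refine Integrable.of_bound (hc.measurable.mul hΩ.measurable).aestronglyMeasurable (CD * CΩ) (ae_of_all _ fun V => ?_)
  rw [Real.norm_eq_abs, abs_mul]
  exact mul_le_mul (hCD V) (hCΩ V) (abs_nonneg _) ((abs_nonneg _).trans (hCD V))

/-- ★ **`FH_{X+Y} = FH_X + FH_Y`.** [cite: Creutz2022, Ch. 11] -/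
theorem fh_add (β : ℝ) (e : Edge 3 L) (X Y : Matrix (Fin 2) (Fin 2) ℂ) (U : GaugeConfig 3 L SU2)
    {Ω : GaugeConfig 3 L SU2 → ℝ} (hΩ : IsPhys Ω) :
    ((topValue su2Rep L β)⁻¹ * ∫ V, (transferKernel su2Rep β U V * (β * ((X + Y) * su2Rep (U e) * su2Rep ((V e)⁻¹)).trace.re - β / 2 *
      (∑ p : Plaquette 3 L,
        -(((((if (p.1, p.2.1.1) = e then (X + Y) * su2Rep (U e) else 0) * su2Rep (U (p.1.shift p.2.1.1, p.2.1.2)) +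
              su2Rep (U (p.1, p.2.1.1)) * (if (p.1.shift p.2.1.1, p.2.1.2) = e then (X + Y) * su2Rep (U e) else 0)) *
                su2Rep ((U (p.1.shift p.2.1.2, p.2.1.1))⁻¹) +
            su2Rep (U (p.1, p.2.1.1)) * su2Rep (U (p.1.shift p.2.1.1, p.2.1.2)) *
              (if (p.1.shift p.2.1.2, p.2.1.1) = e then su2Rep ((U e)⁻¹) * (-(X + Y)) else 0)) * su2Rep ((U (p.1, p.2.1.2))⁻¹) +
          su2Rep (U (p.1, p.2.1.1)) * su2Rep (U (p.1.shift p.2.1.1, p.2.1.2)) * su2Rep ((U (p.1.shift p.2.1.2, p.2.1.1))⁻¹) *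
            (if (p.1, p.2.1.2) = e then su2Rep ((U e)⁻¹) * (-(X + Y)) else 0)).trace.re)))) * Ω V ∂(configMeasure SU2 L)) =
      ((topValue su2Rep L β)⁻¹ * ∫ V, (transferKernel su2Rep β U V * (β * (X * su2Rep (U e) * su2Rep ((V e)⁻¹)).trace.re - β / 2 *
      (∑ p : Plaquette 3 L,
        -(((((if (p.1, p.2.1.1) = e then X * su2Rep (U e) else 0) * su2Rep (U (p.1.shift p.2.1.1, p.2.1.2)) +
              su2Rep (U (p.1, p.2.1.1)) * (if (p.1.shift p.2.1.1, p.2.1.2) = e then X * su2Rep (U e) else 0)) *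
                su2Rep ((U (p.1.shift p.2.1.2, p.2.1.1))⁻¹) +
            su2Rep (U (p.1, p.2.1.1)) * su2Rep (U (p.1.shift p.2.1.1, p.2.1.2)) *
              (if (p.1.shift p.2.1.2, p.2.1.1) = e then su2Rep ((U e)⁻¹) * (-X) else 0)) * su2Rep ((U (p.1, p.2.1.2))⁻¹) +
          su2Rep (U (p.1, p.2.1.1)) * su2Rep (U (p.1.shift p.2.1.1, p.2.1.2)) * su2Rep ((U (p.1.shift p.2.1.2, p.2.1.1))⁻¹) *
            (if (p.1, p.2.1.2) = e then su2Rep ((U e)⁻¹) * (-X) else 0)).trace.re)))) * Ω V ∂(configMeasure SU2 L)) +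
      ((topValue su2Rep L β)⁻¹ * ∫ V, (transferKernel su2Rep β U V * (β * (Y * su2Rep (U e) * su2Rep ((V e)⁻¹)).trace.re - β / 2 *
      (∑ p : Plaquette 3 L,
        -(((((if (p.1, p.2.1.1) = e then Y * su2Rep (U e) else 0) * su2Rep (U (p.1.shift p.2.1.1, p.2.1.2)) +
              su2Rep (U (p.1, p.2.1.1)) * (if (p.1.shift p.2.1.1, p.2.1.2) = e then Y * su2Rep (U e) else 0)) *
                su2Rep ((U (p.1.shift p.2.1.2, p.2.1.1))⁻¹) +
            su2Rep (U (p.1, p.2.1.1)) * su2Rep (U (p.1.shift p.2.1.1, p.2.1.2)) *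
              (if (p.1.shift p.2.1.2, p.2.1.1) = e then su2Rep ((U e)⁻¹) * (-Y) else 0)) * su2Rep ((U (p.1, p.2.1.2))⁻¹) +
          su2Rep (U (p.1, p.2.1.1)) * su2Rep (U (p.1.shift p.2.1.1, p.2.1.2)) * su2Rep ((U (p.1.shift p.2.1.2, p.2.1.1))⁻¹) *
            (if (p.1, p.2.1.2) = e then su2Rep ((U e)⁻¹) * (-Y) else 0)).trace.re)))) * Ω V ∂(configMeasure SU2 L)) := by
  rw [← mul_add, ← integral_add (integrable_kernelDeriv_mul β e X U hΩ) (integrable_kernelDeriv_mul β e Y U hΩ)]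
  congr 1
  refine integral_congr_ae (ae_of_all _ fun V => ?_)
  dsimp only
  rw [kernelDeriv_add, add_mul]

/-- ★ **`FH_{rX} = r FH_X`** (`r` real). [cite: Creutz2022, Ch. 11] -/
theorem fh_smul (β : ℝ) (e : Edge 3 L) (r : ℝ) (X : Matrix (Fin 2) (Fin 2) ℂ) (U : GaugeConfig 3 L SU2)
    (Ω : GaugeConfig 3 L SU2 → ℝ) :
    ((topValue su2Rep L β)⁻¹ * ∫ V, (transferKernel su2Rep β U V * (β * (((r : ℂ) • X) * su2Rep (U e) * su2Rep ((V e)⁻¹)).trace.re - β / 2 *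
      (∑ p : Plaquette 3 L,
        -(((((if (p.1, p.2.1.1) = e then ((r : ℂ) • X) * su2Rep (U e) else 0) * su2Rep (U (p.1.shift p.2.1.1, p.2.1.2)) +
              su2Rep (U (p.1, p.2.1.1)) * (if (p.1.shift p.2.1.1, p.2.1.2) = e then ((r : ℂ) • X) * su2Rep (U e) else 0)) *
                su2Rep ((U (p.1.shift p.2.1.2, p.2.1.1))⁻¹) +
            su2Rep (U (p.1, p.2.1.1)) * su2Rep (U (p.1.shift p.2.1.1, p.2.1.2)) *
              (if (p.1.shift p.2.1.2, p.2.1.1) = e then su2Rep ((U e)⁻¹) * (-((r : ℂ) • X)) else 0)) * su2Rep ((U (p.1, p.2.1.2))⁻¹) +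
          su2Rep (U (p.1, p.2.1.1)) * su2Rep (U (p.1.shift p.2.1.1, p.2.1.2)) * su2Rep ((U (p.1.shift p.2.1.2, p.2.1.1))⁻¹) *
            (if (p.1, p.2.1.2) = e then su2Rep ((U e)⁻¹) * (-((r : ℂ) • X)) else 0)).trace.re)))) * Ω V ∂(configMeasure SU2 L)) =
      r * ((topValue su2Rep L β)⁻¹ * ∫ V, (transferKernel su2Rep β U V * (β * (X * su2Rep (U e) * su2Rep ((V e)⁻¹)).trace.re - β / 2 *
      (∑ p : Plaquette 3 L,
        -(((((if (p.1, p.2.1.1) = e then X * su2Rep (U e) else 0) * su2Rep (U (p.1.shift p.2.1.1, p.2.1.2)) +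
              su2Rep (U (p.1, p.2.1.1)) * (if (p.1.shift p.2.1.1, p.2.1.2) = e then X * su2Rep (U e) else 0)) *
                su2Rep ((U (p.1.shift p.2.1.2, p.2.1.1))⁻¹) +
            su2Rep (U (p.1, p.2.1.1)) * su2Rep (U (p.1.shift p.2.1.1, p.2.1.2)) *
              (if (p.1.shift p.2.1.2, p.2.1.1) = e then su2Rep ((U e)⁻¹) * (-X) else 0)) * su2Rep ((U (p.1, p.2.1.2))⁻¹) +
          su2Rep (U (p.1, p.2.1.1)) * su2Rep (U (p.1.shift p.2.1.1, p.2.1.2)) * su2Rep ((U (p.1.shift p.2.1.2, p.2.1.1))⁻¹) *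
            (if (p.1, p.2.1.2) = e then su2Rep ((U e)⁻¹) * (-X) else 0)).trace.re)))) * Ω V ∂(configMeasure SU2 L)) := by
  have h : ∫ V, (transferKernel su2Rep β U V * (β * (((r : ℂ) • X) * su2Rep (U e) * su2Rep ((V e)⁻¹)).trace.re - β / 2 *
      (∑ p : Plaquette 3 L,
        -(((((if (p.1, p.2.1.1) = e then ((r : ℂ) • X) * su2Rep (U e) else 0) * su2Rep (U (p.1.shift p.2.1.1, p.2.1.2)) +
              su2Rep (U (p.1, p.2.1.1)) * (if (p.1.shift p.2.1.1, p.2.1.2) = e then ((r : ℂ) • X) * su2Rep (U e) else 0)) *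
                su2Rep ((U (p.1.shift p.2.1.2, p.2.1.1))⁻¹) +
            su2Rep (U (p.1, p.2.1.1)) * su2Rep (U (p.1.shift p.2.1.1, p.2.1.2)) *
              (if (p.1.shift p.2.1.2, p.2.1.1) = e then su2Rep ((U e)⁻¹) * (-((r : ℂ) • X)) else 0)) * su2Rep ((U (p.1, p.2.1.2))⁻¹) +
          su2Rep (U (p.1, p.2.1.1)) * su2Rep (U (p.1.shift p.2.1.1, p.2.1.2)) * su2Rep ((U (p.1.shift p.2.1.2, p.2.1.1))⁻¹) *
            (if (p.1, p.2.1.2) = e then su2Rep ((U e)⁻¹) * (-((r : ℂ) • X)) else 0)).trace.re)))) * Ω V ∂(configMeasure SU2 L) =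
      r * ∫ V, (transferKernel su2Rep β U V * (β * (X * su2Rep (U e) * su2Rep ((V e)⁻¹)).trace.re - β / 2 *
      (∑ p : Plaquette 3 L,
        -(((((if (p.1, p.2.1.1) = e then X * su2Rep (U e) else 0) * su2Rep (U (p.1.shift p.2.1.1, p.2.1.2)) +
              su2Rep (U (p.1, p.2.1.1)) * (if (p.1.shift p.2.1.1, p.2.1.2) = e then X * su2Rep (U e) else 0)) *
                su2Rep ((U (p.1.shift p.2.1.2, p.2.1.1))⁻¹) +
            su2Rep (U (p.1, p.2.1.1)) * su2Rep (U (p.1.shift p.2.1.1, p.2.1.2)) *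
              (if (p.1.shift p.2.1.2, p.2.1.1) = e then su2Rep ((U e)⁻¹) * (-X) else 0)) * su2Rep ((U (p.1, p.2.1.2))⁻¹) +
          su2Rep (U (p.1, p.2.1.1)) * su2Rep (U (p.1.shift p.2.1.1, p.2.1.2)) * su2Rep ((U (p.1.shift p.2.1.2, p.2.1.1))⁻¹) *
            (if (p.1, p.2.1.2) = e then su2Rep ((U e)⁻¹) * (-X) else 0)).trace.re)))) * Ω V ∂(configMeasure SU2 L) := by
    rw [← integral_const_mul]
    refine integral_congr_ae (ae_of_all _ fun V => ?_)
    dsimp only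
    rw [kernelDeriv_smul, mul_assoc]
  rw [h]
  ring

/-- ★ **Continuity of `U ↦ FH_{X(U)}(U)` for a continuous generator field `X : Config → M₂(ℂ)`** (dominated convergence: the density is
jointly continuous on the compact `Config × Config`, `Ω` is bounded measurable). [cite: ReedSimonIV1978, Thm. XIII.43] -/
theorem continuous_fh_of_continuous (β : ℝ) (e : Edge 3 L) {Xf : GaugeConfig 3 L SU2 → Matrix (Fin 2) (Fin 2) ℂ} (hXf : Continuous Xf)
    {Ω : GaugeConfig 3 L SU2 → ℝ} (hΩ : IsPhys Ω) :
    Continuous fun U : GaugeConfig 3 L SU2 => ((topValue su2Rep L β)⁻¹ * ∫ V, (transferKernel su2Rep β U V * (β * ((Xf U) * su2Rep (U e) * su2Rep ((V e)⁻¹)).trace.re - β / 2 *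
      (∑ p : Plaquette 3 L,
        -(((((if (p.1, p.2.1.1) = e then (Xf U) * su2Rep (U e) else 0) * su2Rep (U (p.1.shift p.2.1.1, p.2.1.2)) +
              su2Rep (U (p.1, p.2.1.1)) * (if (p.1.shift p.2.1.1, p.2.1.2) = e then (Xf U) * su2Rep (U e) else 0)) *
                su2Rep ((U (p.1.shift p.2.1.2, p.2.1.1))⁻¹) +
            su2Rep (U (p.1, p.2.1.1)) * su2Rep (U (p.1.shift p.2.1.1, p.2.1.2)) *
              (if (p.1.shift p.2.1.2, p.2.1.1) = e then su2Rep ((U e)⁻¹) * (-(Xf U)) else 0)) * su2Rep ((U (p.1, p.2.1.2))⁻¹) +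
          su2Rep (U (p.1, p.2.1.1)) * su2Rep (U (p.1.shift p.2.1.1, p.2.1.2)) * su2Rep ((U (p.1.shift p.2.1.2, p.2.1.1))⁻¹) *
            (if (p.1, p.2.1.2) = e then su2Rep ((U e)⁻¹) * (-(Xf U)) else 0)).trace.re)))) * Ω V ∂(configMeasure SU2 L)) := by
  haveI : SecondCountableTopology SU2 := secondCountableTopology_su2
  haveI : IsProbabilityMeasure (configMeasure SU2 L) := by unfold configMeasure; infer_instance
  have hj : Continuous fun q : GaugeConfig 3 L SU2 × GaugeConfig 3 L SU2 => (transferKernel su2Rep β q.1 q.2 * (β * ((Xf q.1) * su2Rep (q.1 e) * su2Rep ((q.2 e)⁻¹)).trace.re - β / 2 *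
      (∑ p : Plaquette 3 L,
        -(((((if (p.1, p.2.1.1) = e then (Xf q.1) * su2Rep (q.1 e) else 0) * su2Rep (q.1 (p.1.shift p.2.1.1, p.2.1.2)) +
              su2Rep (q.1 (p.1, p.2.1.1)) * (if (p.1.shift p.2.1.1, p.2.1.2) = e then (Xf q.1) * su2Rep (q.1 e) else 0)) *
                su2Rep ((q.1 (p.1.shift p.2.1.2, p.2.1.1))⁻¹) +
            su2Rep (q.1 (p.1, p.2.1.1)) * su2Rep (q.1 (p.1.shift p.2.1.1, p.2.1.2)) *
              (if (p.1.shift p.2.1.2, p.2.1.1) = e then su2Rep ((q.1 e)⁻¹) * (-(Xf q.1)) else 0)) * su2Rep ((q.1 (p.1, p.2.1.2))⁻¹) +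
          su2Rep (q.1 (p.1, p.2.1.1)) * su2Rep (q.1 (p.1.shift p.2.1.1, p.2.1.2)) * su2Rep ((q.1 (p.1.shift p.2.1.2, p.2.1.1))⁻¹) *
            (if (p.1, p.2.1.2) = e then su2Rep ((q.1 e)⁻¹) * (-(Xf q.1)) else 0)).trace.re)))) :=
    continuous_kernelDeriv_comp (L := L) β e (hXf.comp continuous_fst) continuous_fst continuous_snd
  obtain ⟨CD, hCD0, hCD⟩ := exists_abs_le_of_continuous hj
  obtain ⟨CΩ, hCΩ⟩ := hΩ.bounded
  refine continuous_const.mul ?_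
  refine continuous_of_dominated (bound := fun _ => CD * CΩ) (fun U => ?_) (fun U => ae_of_all _ fun V => ?_)
    (integrable_const _) (ae_of_all _ fun V => ?_)
  · exact ((continuous_kernelDeriv_comp (L := L) β e (continuous_const : Continuous fun _ : GaugeConfig 3 L SU2 => Xf U)
      continuous_const continuous_id).measurable.mul hΩ.measurable).aestronglyMeasurable
  · rw [Real.norm_eq_abs, abs_mul]
    exact mul_le_mul (hCD (U, V)) (hCΩ V) (abs_nonneg _) hCD0
  · exact (continuous_kernelDeriv_comp (L := L) β e hXf continuous_id continuous_const).mul continuous_const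

/-! ## §5 ★★ Right `expPauli` shifts: the vacuum derivative is linear in the direction and continuous along continuous direction fields -/

/-- The conjugate generator `U_e su2Coord(a) U_e⁻¹` is additive in `a`. [folklore] -/
theorem conjGen_add (g : SU2) (a b : EuclideanSpace ℝ (Fin 3)) :
    su2Rep g * su2Coord (WithLp.ofLp (a + b)) * (su2Rep g)⁻¹ =
      su2Rep g * su2Coord (WithLp.ofLp a) * (su2Rep g)⁻¹ + su2Rep g * su2Coord (WithLp.ofLp b) * (su2Rep g)⁻¹ := by
  -- additivity of Print's coordinates (tree `B10Eq18SigmaSU2Chart.su2Coord_add`, restated inline to keep the import closure small)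
  have hadd : su2Coord (WithLp.ofLp a + WithLp.ofLp b) = su2Coord (WithLp.ofLp a) + su2Coord (WithLp.ofLp b) := by
    ext i j
    fin_cases i <;> fin_cases j <;> simp [su2Coord, Complex.ofReal_add] <;> ring
  rw [WithLp.ofLp_add, hadd, Matrix.mul_add, Matrix.add_mul]

/-- The conjugate generator is real-homogeneous in `a`. [folklore] -/
theorem conjGen_smul (g : SU2) (r : ℝ) (a : EuclideanSpace ℝ (Fin 3)) :
    su2Rep g * su2Coord (WithLp.ofLp (r • a)) * (su2Rep g)⁻¹ = (r : ℂ) • (su2Rep g * su2Coord (WithLp.ofLp a) * (su2Rep g)⁻¹) := by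
  rw [WithLp.ofLp_smul, su2Coord_real_smul, Matrix.mul_smul, Matrix.smul_mul]

omit [NeZero L] in
/-- The conjugate generator field `U ↦ U_e su2Coord(a(U)) U_e⁻¹` is continuous for a continuous direction field `a`. [folklore] -/
theorem continuous_conjGen {a : GaugeConfig 3 L SU2 → EuclideanSpace ℝ (Fin 3)} (ha : Continuous a) (e : Edge 3 L) :
    Continuous fun U : GaugeConfig 3 L SU2 => su2Rep (U e) * su2Coord (a U) * (su2Rep (U e))⁻¹ := by
  have hco : Continuous fun x : Fin 3 → ℝ => su2Coord x := by
    refine continuous_matrix fun i j => ?_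
    fin_cases i <;> fin_cases j <;> simp only [su2Coord, Matrix.of_apply, Matrix.cons_val', Matrix.empty_val',
      Matrix.cons_val_fin_one] <;> fun_prop
  have h1 : Continuous fun U : GaugeConfig 3 L SU2 => su2Rep (U e) := continuous_su2Rep.comp (continuous_apply e)
  have h2 : Continuous fun U : GaugeConfig 3 L SU2 => (su2Rep (U e))⁻¹ := by
    have : (fun U : GaugeConfig 3 L SU2 => (su2Rep (U e))⁻¹) = fun U => su2Rep ((U e)⁻¹) := by
      funext U; rw [su2Rep_inv_eq_matrix_inv]
    rw [this]
    exact continuous_su2Rep.comp ((continuous_apply e).inv)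
  exact (h1.mul (hco.comp ((PiLp.continuous_ofLp 2 (fun _ : Fin 3 => ℝ)).comp ha))).mul h2

/-- ★★ **Additivity in the direction**: `∂_{a+b}Ω = ∂_aΩ + ∂_bΩ` for the right `expPauli` shifts at the edge `e`. [cite: ReedSimonIV1978, Thm. XIII.43] -/
theorem deriv_vacuum_rightShift_add (β : ℝ) (e : Edge 3 L) (a b : EuclideanSpace ℝ (Fin 3)) {Ω : GaugeConfig 3 L SU2 → ℝ}
    (hΩ : IsPhys Ω) (heig : transferApply β Ω = topValue su2Rep L β • Ω) (U : GaugeConfig 3 L SU2) :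
    deriv (fun t : ℝ => Ω (Function.update U e (U e * expPauli (t • (a + b))))) 0 =
      deriv (fun t : ℝ => Ω (Function.update U e (U e * expPauli (t • a)))) 0 +
        deriv (fun t : ℝ => Ω (Function.update U e (U e * expPauli (t • b)))) 0 := by
  rw [deriv_vacuum_rightShift β e (a + b) hΩ heig U, deriv_vacuum_rightShift β e a hΩ heig U,
    deriv_vacuum_rightShift β e b hΩ heig U]
  dsimp only
  rw [conjGen_add, fh_add β e _ _ U hΩ]

/-- ★★ **Homogeneity in the direction**: `∂_{ra}Ω = r ∂_aΩ`. [cite: ReedSimonIV1978, Thm. XIII.43] -/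
theorem deriv_vacuum_rightShift_smul (β : ℝ) (e : Edge 3 L) (r : ℝ) (a : EuclideanSpace ℝ (Fin 3)) {Ω : GaugeConfig 3 L SU2 → ℝ}
    (hΩ : IsPhys Ω) (heig : transferApply β Ω = topValue su2Rep L β • Ω) (U : GaugeConfig 3 L SU2) :
    deriv (fun t : ℝ => Ω (Function.update U e (U e * expPauli (t • (r • a))))) 0 =
      r * deriv (fun t : ℝ => Ω (Function.update U e (U e * expPauli (t • a)))) 0 := by
  rw [deriv_vacuum_rightShift β e (r • a) hΩ heig U, deriv_vacuum_rightShift β e a hΩ heig U]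
  dsimp only
  rw [conjGen_smul, fh_smul β e r _ U Ω]

/-- ★★ **Subtraction in the direction**: `∂_{a−b}Ω = ∂_aΩ − ∂_bΩ`. [cite: ReedSimonIV1978, Thm. XIII.43] -/
theorem deriv_vacuum_rightShift_sub (β : ℝ) (e : Edge 3 L) (a b : EuclideanSpace ℝ (Fin 3)) {Ω : GaugeConfig 3 L SU2 → ℝ}
    (hΩ : IsPhys Ω) (heig : transferApply β Ω = topValue su2Rep L β • Ω) (U : GaugeConfig 3 L SU2) :
    deriv (fun t : ℝ => Ω (Function.update U e (U e * expPauli (t • (a - b))))) 0 =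
      deriv (fun t : ℝ => Ω (Function.update U e (U e * expPauli (t • a)))) 0 -
        deriv (fun t : ℝ => Ω (Function.update U e (U e * expPauli (t • b)))) 0 := by
  have h := deriv_vacuum_rightShift_add β e (a - b) b hΩ heig U
  rw [sub_add_cancel] at h
  linarith

/-- ★★ **Continuity along a continuous direction field**: for continuous `a : Config → ℝ³`,
`U ↦ deriv (t ↦ Ω(U[e ↦ U_e expPauli(t•a(U))])) 0` is continuous. [cite: ReedSimonIV1978, Thm. XIII.43] -/
theorem continuous_deriv_vacuum_rightShift (β : ℝ) (e : Edge 3 L) {a : GaugeConfig 3 L SU2 → EuclideanSpace ℝ (Fin 3)}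
    (ha : Continuous a) {Ω : GaugeConfig 3 L SU2 → ℝ} (hΩ : IsPhys Ω) (heig : transferApply β Ω = topValue su2Rep L β • Ω) :
    Continuous fun U : GaugeConfig 3 L SU2 => deriv (fun t : ℝ => Ω (Function.update U e (U e * expPauli (t • a U)))) 0 := by
  have h := continuous_fh_of_continuous β e (continuous_conjGen ha e) hΩ
  refine h.congr fun U => ?_
  exact (deriv_vacuum_rightShift β e (a U) hΩ heig U).symm

/-- ★ **Boundedness** along a continuous direction field. [cite: ReedSimonIV1978, Thm. XIII.43] -/
theorem bounded_deriv_vacuum_rightShift (β : ℝ) (e : Edge 3 L) {a : GaugeConfig 3 L SU2 → EuclideanSpace ℝ (Fin 3)}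
    (ha : Continuous a) {Ω : GaugeConfig 3 L SU2 → ℝ} (hΩ : IsPhys Ω) (heig : transferApply β Ω = topValue su2Rep L β • Ω) :
    ∃ C : ℝ, 0 ≤ C ∧ ∀ U : GaugeConfig 3 L SU2, |deriv (fun t : ℝ => Ω (Function.update U e (U e * expPauli (t • a U)))) 0| ≤ C :=
  exists_abs_le_of_continuous (continuous_deriv_vacuum_rightShift β e ha hΩ heig)

/-- ★ **Measurability** along a continuous direction field. [cite: ReedSimonIV1978, Thm. XIII.43] -/
theorem measurable_deriv_vacuum_rightShift (β : ℝ) (e : Edge 3 L) {a : GaugeConfig 3 L SU2 → EuclideanSpace ℝ (Fin 3)}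
    (ha : Continuous a) {Ω : GaugeConfig 3 L SU2 → ℝ} (hΩ : IsPhys Ω) (heig : transferApply β Ω = topValue su2Rep L β • Ω) :
    Measurable fun U : GaugeConfig 3 L SU2 => deriv (fun t : ℝ => Ω (Function.update U e (U e * expPauli (t • a U)))) 0 := by
  haveI : SecondCountableTopology SU2 := secondCountableTopology_su2
  exact (continuous_deriv_vacuum_rightShift β e ha hΩ heig).measurable

end Summit.QuantumFields.YangMills.Theorems.TransportField

end
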